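import Literature.AnabelianGeometry.SemiGraphs.TieBijective

/-!
# The canonical labels satisfy the branch clause of the local description ([SemiAnbd] Def. 2.2 (i) p. 23)

Mochizuki, *Semi-graphs of anabelioids*, Publ. RIMS **42** (2006) 221–322, §2, Def. 2.2 (i) p. 23: a
branch of the edge `(e, Q)` of the covering attached to `A ∈ B(𝒦)` abuts to the vertex `(v, P)` of the
component `P ⊆ A_v` under which `Q ⊆ A_e` lies via `ψ_b` [cite: MochizukiSemiAnbd2006, Def. 2.2(i) p.23].

PROOF-ONLY corollary (abc-iut cell, layer L3; FACT-LIST row F-1478 / F-1487, brick (T-δ) of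
`HOME/staging/f/f-161/J1-TIE-ROUTE.md`, in the SHAPE abc-iut-L3-d3's G-E3 assembly binds: «labels w.r.t.
`A`, bijective, `IsFiniteEtaleCoveringOf`-shaped branch clause, and the global section factors through
them»; seat abc-iut-f-161).  The abutment compatibility of `TieBijective.tie_bijective` (clause 5, "the
component under `O(e(b′))` along `ψ b′` is `O(w)`") is converted into the branch clause in the literal
shape of abc-iut-L3-t1's `Hom.IsFiniteEtaleCoveringOf` (an arrow into the `transportE`-re-indexed
`b^*(O w)` composing to the inclusion of `O(e(b′))`):

* `BObj.branchClause_of_le_mk` — the converse of `TieLocalStars`' `le_mk_of_branchClause`;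
* `Hom.branchClause_of_componentOver_eq` — for ANY labels, clause-5 form ⇒ branch-clause form;
* `Hom.tie_localLabels` — `tie_bijective` with clause 5 in branch-clause form.

No `def`, no new `Prop`; nothing here takes a side on [IUTchIII] Cor. 3.12.
-/

namespace Literature.AnabelianGeometry.SemiGraphs

namespace SemiGraphOfAnabelioids

open CategoryTheory CategoryTheory.Limits CategoryTheory.PreGaloisCategory
open Literature.AnabelianGeometry.Anabelioids

universe v₁ u₁ u

variable {ℋ 𝒦 : SemiGraphOfAnabelioids.{v₁, u₁, u}}

namespace BObj

variable (A : 𝒦.BObj)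

/-- An inclusion of subobjects of `T_{e₁}`, read across a re-indexing `h : e₁ = e₂` of edges by
`transportE`, in the shape of the branch clause of `IsFiniteEtaleCoveringOf` (converse of
`le_mk_of_branchClause`). [cite: MochizukiSemiAnbd2006, Def. 2.2(i) p.23] -/
theorem branchClause_of_le_mk {e₁ e₂ : 𝒦.graph.Edge} (he : e₁ = e₂) {X : 𝒦.E e₁} (g : X ⟶ A.T e₁)
    [Mono g] (Q : π₀Obj (A.T e₂)) (hle : (he.symm ▸ Q : π₀Obj (A.T e₁)).1 ≤ Subobject.mk g) :
    ∃ f : (Q.1 : 𝒦.E e₂) ⟶ (𝒦.transportE he).obj X,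
      f ≫ (𝒦.transportE he).map g ≫ eqToHom (𝒦.transportE_obj_T A he) = Q.1.arrow := by
  cases he
  have hle' : Q.1 ≤ Subobject.mk g := hle
  let f₀ : (Q.1 : 𝒦.E e₁) ⟶ X := Subobject.ofLEMk Q.1 g hle'
  refine ⟨f₀, ?_⟩
  change f₀ ≫ g ≫ 𝟙 _ = _
  rw [Category.comp_id]
  exact Subobject.ofLEMk_comp hle'

end BObj

namespace Hom

variable (ψ : Hom ℋ 𝒦) (A : 𝒦.BObj)

/-- **Abutment compatibility ⇒ the branch clause.**  For ANY labels `oV w ⊆ A_{ψ w}`, `oE e′ ⊆ A_{ψ e′}`: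
if for every branch `b′` at `w` the component of `A_{ψ w}` under `oE(e(b′))` along `ψ b′` is `oV w`, then
the branch clause of `Hom.IsFiniteEtaleCoveringOf` holds for `(oV, oE)`.
[cite: MochizukiSemiAnbd2006, Def. 2.2(i) p.23] -/
theorem branchClause_of_componentOver_eq (oV : ∀ w : ℋ.graph.Vertex, π₀Obj (A.S (ψ.base.vertexMap w)))
    (oE : ∀ e' : ℋ.graph.Edge, π₀Obj (A.T (ψ.base.edgeMap e')))
    (h5 : ∀ (b' : ℋ.graph.Branch) (w : ℋ.graph.Vertex) (h' : ℋ.graph.abuts b' = some w),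
      A.componentOver (ψ.base.branchMap b') (ψ.base.vertexMap w) (ψ.base.abuts_branchMap b' w h')
        ((ψ.base.edgeOf_branchMap b').symm ▸ oE (ℋ.graph.edgeOf b')) = oV w)
    (b' : ℋ.graph.Branch) (v' : ℋ.graph.Vertex) (h' : ℋ.graph.abuts b' = some v') :
    ∃ f : ((oE (ℋ.graph.edgeOf b')).1 : 𝒦.E (ψ.base.edgeMap (ℋ.graph.edgeOf b'))) ⟶
        (𝒦.transportE (ψ.base.edgeOf_branchMap b')).obj
          ((𝒦.pull (ψ.base.branchMap b') (ψ.base.vertexMap v')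
            (ψ.base.abuts_branchMap b' v' h')).pullback.obj ((oV v').1 : 𝒦.V (ψ.base.vertexMap v'))),
      f ≫ (𝒦.transportE (ψ.base.edgeOf_branchMap b')).map
            ((𝒦.pull _ _ (ψ.base.abuts_branchMap b' v' h')).pullback.map (oV v').1.arrow ≫
              (A.ψ (ψ.base.branchMap b') (ψ.base.vertexMap v') (ψ.base.abuts_branchMap b' v' h')).hom) ≫
          eqToHom (𝒦.transportE_obj_T A (ψ.base.edgeOf_branchMap b')) =
        (oE (ℋ.graph.edgeOf b')).1.arrow := by
  haveI := A.mono_map_arrow_comp_ψ (ψ.base.branchMap b') (ψ.base.vertexMap v')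
    (ψ.base.abuts_branchMap b' v' h') (oV v').1
  refine A.branchClause_of_le_mk (ψ.base.edgeOf_branchMap b') _ (oE (ℋ.graph.edgeOf b')) ?_
  exact (A.componentOver_eq_iff_le_branchImage _ _ _ _ _).mp (h5 b' v' h')

variable [HasBinaryProducts 𝒦.BObj] (αψ : Over A ⥤ ℋ.BObj) [αψ.IsEquivalence]
  (eψ : ψ.pullbackFunctor ≅ Over.star A ⋙ αψ)

/-- **THE TIE, branch-clause form** (the shape abc-iut-L3-d3's G-E3 assembly binds).  For a morphism
`ψ : ℋ → 𝒦` of connected semi-graphs of anabelioids which is locally the covering attached to `A`,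
globally so through `αψ`, `e_ψ`, branch-aligned and vertex-aligned: there are labels `O(w) ⊆ A_{ψ w}`,
`O(e′) ⊆ A_{ψ e′}` with (1)/(2) `w ↦ (ψ w, O w)`, `e′ ↦ (ψ e′, O e′)` bijective; (3)/(4) the constituents of
the tautological section `g = αψ(η_{𝟙_A}) ≫ e_ψ⁻¹_A` factor through `ψ_w^*(O w ↪ A_{ψ w})`,
`ψ_{e′}^*(O e′ ↪ A_{ψ e′})` (and only through these components); (5) the branch clause of
`Hom.IsFiniteEtaleCoveringOf` holds for `(O, O_E)`. [cite: MochizukiSemiAnbd2006, Def. 2.2(i) p.23] -/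
theorem tie_localLabels (hloc : ψ.IsFiniteEtaleCoveringOf A) (hal : ψ.IsBranchAligned)
    (hva : ψ.IsVertexAligned) (hℋ : ℋ.IsConnected) (h𝒦 : 𝒦.IsConnected) :
    ∃ (O : ∀ w : ℋ.graph.Vertex, π₀Obj (A.S (ψ.base.vertexMap w)))
      (OE : ∀ e' : ℋ.graph.Edge, π₀Obj (A.T (ψ.base.edgeMap e'))),
      Function.Bijective (fun w : ℋ.graph.Vertex =>
        (⟨ψ.base.vertexMap w, O w⟩ : Σ u, π₀Obj (A.S u))) ∧
      Function.Bijective (fun e' : ℋ.graph.Edge =>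
        (⟨ψ.base.edgeMap e', OE e'⟩ : Σ e, π₀Obj (A.T e))) ∧
      (∀ (w : ℋ.graph.Vertex) (P : π₀Obj (A.S (ψ.base.vertexMap w))),
        P = O w ↔ ∃ k : (αψ.obj (Over.mk (𝟙 A))).S w ⟶
            (ψ.φV w).pullback.obj (P.1 : 𝒦.V (ψ.base.vertexMap w)),
          k ≫ (ψ.φV w).pullback.map P.1.arrow =
            (αψ.map ((Over.forgetAdjStar A).unit.app (Over.mk (𝟙 A))) ≫ eψ.inv.app A).fS w) ∧
      (∀ (e' : ℋ.graph.Edge) (Q : π₀Obj (A.T (ψ.base.edgeMap e'))),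
        Q = OE e' ↔ ∃ k : (αψ.obj (Over.mk (𝟙 A))).T e' ⟶
            (ψ.φE e' (ψ.base.edgeMap e') rfl).pullback.obj (Q.1 : 𝒦.E (ψ.base.edgeMap e')),
          k ≫ (ψ.φE e' (ψ.base.edgeMap e') rfl).pullback.map Q.1.arrow =
            (αψ.map ((Over.forgetAdjStar A).unit.app (Over.mk (𝟙 A))) ≫ eψ.inv.app A).fT e') ∧
      (∀ (b' : ℋ.graph.Branch) (v' : ℋ.graph.Vertex) (h' : ℋ.graph.abuts b' = some v'),
        ∃ f : ((OE (ℋ.graph.edgeOf b')).1 : 𝒦.E (ψ.base.edgeMap (ℋ.graph.edgeOf b'))) ⟶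
            (𝒦.transportE (ψ.base.edgeOf_branchMap b')).obj
              ((𝒦.pull (ψ.base.branchMap b') (ψ.base.vertexMap v')
                (ψ.base.abuts_branchMap b' v' h')).pullback.obj ((O v').1 : 𝒦.V (ψ.base.vertexMap v'))),
          f ≫ (𝒦.transportE (ψ.base.edgeOf_branchMap b')).map
                ((𝒦.pull _ _ (ψ.base.abuts_branchMap b' v' h')).pullback.map (O v').1.arrow ≫
                  (A.ψ (ψ.base.branchMap b') (ψ.base.vertexMap v') (ψ.base.abuts_branchMap b' v' h')).hom) ≫
              eqToHom (𝒦.transportE_obj_T A (ψ.base.edgeOf_branchMap b')) =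
            (OE (ℋ.graph.edgeOf b')).1.arrow) := by
  obtain ⟨O, OE, h1, h2, h3, h4, h5⟩ := tie_bijective ψ A αψ eψ hloc hal hva hℋ h𝒦
  exact ⟨O, OE, h1, h2, h3, h4, branchClause_of_componentOver_eq ψ A O OE h5⟩

end Hom

end SemiGraphOfAnabelioids

end Literature.AnabelianGeometry.SemiGraphs
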